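import Literature.Topology.FourManifolds.KhComplex
import HarnessLib

/-!
# Inserting a chord: positions, chords, states and Koszul signs of `GaussDiagram.insertChord`

Sibling file of `KhComplex.lean` / `KhResolutions.lean` (topic `Literature/Topology/FourManifolds`),
a brick of the invariance programme for the named fact
`Literature.Topology.FourManifolds.GaussDiagram.nonempty_iso_khovanovHomology_of_equiv`
(Khovanov (2000), Thm. 1). The first and second Reidemeister moves on Gauss diagrams
(`PolyakMove.omega1a`, `omega1b`, `omega2a`) are written with the bookkeeping operation
`G.insertChord o u ε` of `GaussDiagrams.lean` (a new chord, of index `Fin.last n` and sign `ε`,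
with over-passage at the new position `o` and under-passage at the new position
`o.succAbove u`; the old marked point `q` becomes `o.succAbove (u.succAbove q)`). This file
records, for an *arbitrary* insertion, how the resolution data of `KhResolutions`/`KhComplex`
of the new diagram restrict to the old chords:

* `insEmb o u : Fin (2n) → Fin (2n + 2)`, the strictly monotone embedding of the old marked
  points, whose complement is the pair of new points (`eq_insEmb_or_eq_or_eq`);
* the chord through / the partner of an embedded point or a new point
  (`chordOf_insertChord_insEmb`, `partner_insertChord_insEmb`, `…_fst`, `…_snd`);
* states of the new diagram as `Fin.snoc σ b` (old smoothings `σ`, smoothing `b` of the new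
  chord): the Seifert rule (`isSeifert_insertChord_castSucc`, `…_last`), the weight
  (`weight_snoc`), `n₊`, `n₋` (`nPlus_insertChord`, `nMinus_insertChord`), and the Koszul signs:
  **old chords keep their Koszul signs and the new (last) chord has Koszul sign `(-1)^{|σ|}`**
  (`edgeSign_snoc_castSucc`, `edgeSign_snoc_last`) — the sign bookkeeping behind the cone
  description of the complex of a diagram with one more crossing (Khovanov (2000), §3.3 and
  §4.2: `C(D)` as the cone of the map between the complexes of the two resolutions of a
  crossing; Bar-Natan (2002), §3.2–3.3).

Everything is proved, for every Gauss diagram; no named fact is introduced.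

## References

* M. Khovanov, *A categorification of the Jones polynomial*, Duke Math. J. 101 (2000) 359–426,
  §3.3 (signs on the cube), §4.2 (the complex of a diagram; adding a crossing).
  [cite: Khovanov2000, §4.2]
* D. Bar-Natan, *On Khovanov's categorification of the Jones polynomial*, Algebr. Geom. Topol. 2
  (2002) 337–370, §3.2–3.3. [cite: BarNatan2002, §3.2]
* M. Polyak, *Minimal generating sets of Reidemeister moves*, Quantum Topol. 1 (2010), §2
  (the moves on Gauss diagrams). [cite: Polyak2010, §2]
-/

open Function Set

noncomputable section

namespace Literature.Topology.FourManifolds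

namespace GaussDiagram

variable (G : GaussDiagram) (o : Fin (2 * G.n + 2)) (u : Fin (2 * G.n + 1)) (ε : ℤˣ)

/-! ## The embedding of the old marked points -/

/-- The **embedding of the old marked points** into the marked points of `G.insertChord o u ε`:
`q ↦ o.succAbove (u.succAbove q)` (the old points keep their cyclic order and fill the `2n`
positions other than the two new ones). Polyak (2010), §2. [cite: Polyak2010, §2] -/
def insEmb (q : Fin (2 * G.n)) : Fin (2 * G.n + 2) :=
  o.succAbove (u.succAbove q)

/-- The embedding of the old points is strictly monotone. [folklore] -/
theorem insEmb_strictMono : StrictMono (G.insEmb o u) :=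
  (Fin.strictMono_succAbove o).comp (Fin.strictMono_succAbove u)

/-- The embedding of the old points is injective. [folklore] -/
theorem insEmb_injective : Injective (G.insEmb o u) :=
  (G.insEmb_strictMono o u).injective

/-- An embedded old point is not the first new point `o`. [folklore] -/
theorem insEmb_ne_fst (q : Fin (2 * G.n)) : G.insEmb o u q ≠ o :=
  Fin.succAbove_ne o _

/-- An embedded old point is not the second new point `o.succAbove u`. [folklore] -/
theorem insEmb_ne_snd (q : Fin (2 * G.n)) : G.insEmb o u q ≠ o.succAbove u := fun h ↦
  Fin.succAbove_ne u q (Fin.succAbove_right_injective h)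

/-- The two new points are distinct. [folklore] -/
theorem fst_ne_snd : o ≠ o.succAbove u :=
  Fin.ne_succAbove o u

/-- Every marked point of the new diagram is an embedded old point or one of the two new
points. [folklore] -/
theorem eq_insEmb_or_eq_or_eq (x : Fin (2 * G.n + 2)) :
    (∃ q, x = G.insEmb o u q) ∨ x = o ∨ x = o.succAbove u := by
  by_cases hx : x = o
  · exact Or.inr (Or.inl hx)
  obtain ⟨y, rfl⟩ := Fin.exists_succAbove_eq hx
  by_cases hy : y = u
  · exact Or.inr (Or.inr (by rw [hy]))
  obtain ⟨q, rfl⟩ := Fin.exists_succAbove_eq hy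
  exact Or.inl ⟨q, rfl⟩

/-! ## Chords of the new diagram -/

/-- Old chords keep their over-passages (through the embedding of the old points). [folklore] -/
@[simp]
theorem insertChord_overPos_castSucc_eq (i : Fin G.n) :
    (G.insertChord o u ε).overPos i.castSucc = G.insEmb o u (G.overPos i) := by
  simp [insertChord, insEmb]

/-- Old chords keep their under-passages (through the embedding of the old points). [folklore] -/
@[simp]
theorem insertChord_underPos_castSucc_eq (i : Fin G.n) :
    (G.insertChord o u ε).underPos i.castSucc = G.insEmb o u (G.underPos i) := by
  simp [insertChord, insEmb]

/-- The chord of the new diagram through an embedded old point is the old chord through that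
point. [folklore] -/
theorem chordOf_insertChord_insEmb (q : Fin (2 * G.n)) :
    (G.insertChord o u ε).chordOf (G.insEmb o u q) = (G.chordOf q).castSucc := by
  obtain ⟨i, rfl | rfl⟩ := G.exists_chord q
  · rw [G.chordOf_overPos, ← insertChord_overPos_castSucc_eq, chordOf_overPos]
  · rw [G.chordOf_underPos, ← insertChord_underPos_castSucc_eq, chordOf_underPos]

/-- The chord through the first new point is the new chord. [folklore] -/
theorem chordOf_insertChord_fst : (G.insertChord o u ε).chordOf o = Fin.last G.n := by
  have h := (G.insertChord o u ε).chordOf_overPos (Fin.last G.n)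
  simp only [insertChord_overPos_last] at h
  exact h

/-- The chord through the second new point is the new chord. [folklore] -/
theorem chordOf_insertChord_snd :
    (G.insertChord o u ε).chordOf (o.succAbove u) = Fin.last G.n := by
  have h := (G.insertChord o u ε).chordOf_underPos (Fin.last G.n)
  simp only [insertChord_underPos_last] at h
  exact h

/-- The partner of an embedded old point is the embedded old partner. [folklore] -/
theorem partner_insertChord_insEmb (q : Fin (2 * G.n)) :
    (G.insertChord o u ε).partner (G.insEmb o u q) = G.insEmb o u (G.partner q) := by
  obtain ⟨i, rfl | rfl⟩ := G.exists_chord q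
  · rw [G.partner_overPos, ← insertChord_overPos_castSucc_eq, partner_overPos,
      insertChord_underPos_castSucc_eq]
  · rw [G.partner_underPos, ← insertChord_underPos_castSucc_eq, partner_underPos,
      insertChord_overPos_castSucc_eq]

/-- The partner of the first new point is the second new point. [folklore] -/
theorem partner_insertChord_fst : (G.insertChord o u ε).partner o = o.succAbove u := by
  have h := (G.insertChord o u ε).partner_overPos (Fin.last G.n)
  simp only [insertChord_overPos_last, insertChord_underPos_last] at h
  exact h

/-- The partner of the second new point is the first new point. [folklore] -/
theorem partner_insertChord_snd : (G.insertChord o u ε).partner (o.succAbove u) = o := by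
  have h := (G.insertChord o u ε).partner_underPos (Fin.last G.n)
  simp only [insertChord_overPos_last, insertChord_underPos_last] at h
  exact h

/-! ## States of the new diagram: `Fin.snoc σ b` -/

/-- Every state of the new diagram is `Fin.snoc σ b`: the old smoothings `σ` and the smoothing
`b` of the new chord `Fin.last n`. [folklore] -/
theorem state_eq_snoc (σ' : (G.insertChord o u ε).State) :
    σ' = Fin.snoc (fun j : Fin G.n ↦ σ' j.castSucc) (σ' (Fin.last G.n)) :=
  (Fin.snoc_init_self σ').symm

/-- The Seifert rule of the new diagram at an old chord is the old Seifert rule. [folklore] -/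
@[simp]
theorem isSeifert_insertChord_castSucc (σ : G.State) (b : Bool) (j : Fin G.n) :
    (G.insertChord o u ε).isSeifert (Fin.snoc σ b) j.castSucc = G.isSeifert σ j := by
  simp [isSeifert, insertChord]

/-- The Seifert rule of the new diagram at the new chord: the `0`-smoothing is Seifert's iff the
new crossing is positive. Bar-Natan (2002), §3.1. [cite: BarNatan2002, §3.1] -/
@[simp]
theorem isSeifert_insertChord_last (σ : G.State) (b : Bool) :
    (G.insertChord o u ε).isSeifert (Fin.snoc σ b) (Fin.last G.n) = ((b == false) == (ε == 1)) := by
  simp [isSeifert, insertChord]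

/-- The weight of a state of the new diagram: the old weight, plus one if the new chord is
`1`-smoothed. Bar-Natan (2002), §3.1. [cite: BarNatan2002, §3.1] -/
theorem weight_snoc (σ : G.State) (b : Bool) :
    State.weight (G := G.insertChord o u ε) (Fin.snoc σ b) = σ.weight + if b then 1 else 0 := by
  unfold State.weight
  rw [Finset.card_filter, Finset.card_filter]
  show (∑ i : Fin (G.n + 1), if (Fin.snoc σ b : Fin (G.n + 1) → Bool) i = true then 1 else 0) = _
  rw [Fin.sum_univ_castSucc]
  simp only [Fin.snoc_castSucc, Fin.snoc_last]

/-- The number of positive crossings of the new diagram. Bar-Natan (2002), §3.1. [cite: BarNatan2002, §3.1] -/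
theorem nPlus_insertChord :
    (G.insertChord o u ε).nPlus = G.nPlus + if ε = 1 then 1 else 0 := by
  unfold nPlus
  rw [Finset.card_filter, Finset.card_filter]
  show (∑ i : Fin (G.n + 1), if (G.insertChord o u ε).sign i = 1 then 1 else 0) = _
  rw [Fin.sum_univ_castSucc]
  simp only [insertChord_sign_castSucc, insertChord_sign_last]

/-- The number of negative crossings of the new diagram. Bar-Natan (2002), §3.1. [cite: BarNatan2002, §3.1] -/
theorem nMinus_insertChord :
    (G.insertChord o u ε).nMinus = G.nMinus + if ε = -1 then 1 else 0 := by
  unfold nMinus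
  rw [Finset.card_filter, Finset.card_filter]
  show (∑ i : Fin (G.n + 1), if (G.insertChord o u ε).sign i = -1 then 1 else 0) = _
  rw [Fin.sum_univ_castSucc]
  simp only [insertChord_sign_castSucc, insertChord_sign_last]

/-- Flipping an old chord commutes with `Fin.snoc`. [folklore] -/
theorem snoc_update_castSucc (σ : G.State) (b : Bool) (j : Fin G.n) (c : Bool) :
    (Fin.snoc (Function.update σ j c) b : (G.insertChord o u ε).State) =
      Function.update (Fin.snoc σ b) j.castSucc c :=
  Fin.snoc_update ..

/-- Flipping the new chord replaces the last entry of `Fin.snoc`. [folklore] -/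
theorem update_snoc_last (σ : G.State) (b c : Bool) :
    Function.update (Fin.snoc σ b : (G.insertChord o u ε).State) (Fin.last G.n) c = Fin.snoc σ c :=
  Fin.update_snoc_last ..

/-! ## Koszul signs -/

/-- **Old chords keep their Koszul signs**: the new chord has the largest index, so it never
enters the count `#{k < j | σ k = 1}` for an old chord `j`. Khovanov (2000), §3.3;
Bar-Natan (2002), §3.2. [cite: Khovanov2000, §3.3] -/
theorem edgeSign_snoc_castSucc (σ : G.State) (b : Bool) (j : Fin G.n) :
    edgeSign (G := G.insertChord o u ε) (Fin.snoc σ b) j.castSucc = edgeSign σ j := by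
  unfold edgeSign
  congr 1
  rw [Finset.card_filter, Finset.card_filter]
  show (∑ i : Fin (G.n + 1),
      if i < j.castSucc ∧ (Fin.snoc σ b : Fin (G.n + 1) → Bool) i = true then 1 else 0) = _
  rw [Fin.sum_univ_castSucc]
  have h : ¬ Fin.last G.n < j.castSucc := not_lt.2 (Fin.castSucc_lt_last j).le
  simp only [Fin.snoc_castSucc, Fin.snoc_last, Fin.castSucc_lt_castSucc_iff, h, false_and,
    if_false, add_zero]

/-- **The Koszul sign of the new (last) chord is `(-1)^{|σ|}`**, the parity of the number of
`1`-smoothed old chords — the sign making the complex of the new diagram the cone of the map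
between the complexes of the two smoothings of the new crossing. Khovanov (2000), §3.3, §4.2;
Bar-Natan (2002), §3.2. [cite: Khovanov2000, §4.2] -/
theorem edgeSign_snoc_last (σ : G.State) (b : Bool) :
    edgeSign (G := G.insertChord o u ε) (Fin.snoc σ b) (Fin.last G.n) = (-1) ^ σ.weight := by
  unfold edgeSign State.weight
  congr 1
  rw [Finset.card_filter, Finset.card_filter]
  show (∑ i : Fin (G.n + 1),
      if i < Fin.last G.n ∧ (Fin.snoc σ b : Fin (G.n + 1) → Bool) i = true then 1 else 0) = _
  rw [Fin.sum_univ_castSucc]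
  simp only [Fin.snoc_castSucc, Fin.snoc_last, Fin.castSucc_lt_last, true_and, lt_irrefl,
    false_and, if_false, add_zero]

end GaussDiagram

end Literature.Topology.FourManifolds
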